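import Literature.MathematicalPhysics.QuantumManyBody.PeriodicBoseGasLocalization
import Literature.MathematicalPhysics.QuantumManyBody.PeriodicBoseGasFourier
import HarnessLib

/-!
# Fournais 2020, (3.19)–(3.21): the Fourier multiplier of the averaged localised kinetic energy

Topic `Literature/MathematicalPhysics/QuantumManyBody`, sibling of `PeriodicBoseGasLocalization.lean`
(provefact `Literature.MathematicalPhysics.QuantumManyBody.BoseGas.Fournais2020_condensation`; the analytic core of the proof of
[Fournais2020, Lemma 3.3] = `Fournais2020_lemma33`).

The printed proof of Lemma 3.3 (pp. 16–17) averages the localised kinetic energy `T_u` (3.13)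
over the position `u ∈ Ω` of the box and observes that the average is diagonal in the plane
waves `e^{ikx}`, `k ∈ 2πL⁻¹ℤ³`, of the torus `Ω = ℝ³/Lℤ³`:
`L⁻³ ∫_Ω ⟨e^{ikx}, T_u e^{ik'x}⟩ du = δ_{k,k'} ℓ³ F(k)` (3.19), `F(k) = ℓ⁻³ ⟨e^{ikx}, T_{u=0} e^{ikx}⟩`
(3.20), so that Lemma 3.3 reduces to the multiplier bound "if `b, s` are small enough, then for
all `k ∈ 2πL⁻¹ℤ³ ∖ {0}`, `F(k) ≤ k² - 2π²L⁻²`" (3.21), proved by scaling to `ℓ = 1` and the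
estimates (3.22)–(3.29) on `F = F₁ + F₂` (small `|k| < ½s⁻¹`: `F₁ ≤ Csk²`, `F₂ ≤ bβk²`; large
`|k|`: `F₁ ≤ k² - ⅛s⁻² + C`). This file vendors (3.21) as a named fact, in the objects of
`PeriodicBoseGasLocalization.lean` (`kinLoc` = the quadratic form of `T_u`) and
`PeriodicBoseGasFourier.lean` (`cellWave L n` = `e^{ikx}`, `k = 2πn/L`); the diagonalisation
(3.19) and the deduction of Lemma 3.3 are proved in the proofs file.

## References

* [Fournais2020] S. Fournais, *Length scales for BEC in the dilute Bose gas*, arXiv:2011.00309,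
  EMS Ser. Congr. Rep. 18 (2021), doi:10.4171/ecr/18-1/7: Lemma 3.3, (3.12)–(3.13), (3.18)–(3.29).
* [BrietzkeFournaisSolovej2020] B. Brietzke, S. Fournais, J. P. Solovej, *A simple 2nd order lower
  bound to the energy of dilute Bose gases*, Comm. Math. Phys. 376 (2020) 323–351,
  arXiv:1901.00539: Lemma 5.7 (5.35)–(5.45) (the whole-space version of the same computation).
-/

noncomputable section

open MeasureTheory
open scoped ENNReal

namespace Literature.MathematicalPhysics.QuantumManyBody.BoseGas

/-- **Fournais 2020, (3.21)** (the multiplier bound behind Lemma 3.3). Let `χ` be a localisation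
function, `T_u = Q_u^*(χ_u[-Δ - s⁻²ℓ⁻²]₊χ_u + bℓ⁻²)Q_u` (3.13) and, for the plane waves `e^{ikx}`,
`k ∈ 2πL⁻¹ℤ³`, of the torus of side `L > 2ℓ`, `F(k) := ℓ⁻³⟨e^{ikx}, T_{u=0} e^{ikx}⟩` (3.20) (the
diagonal (3.19) of the `u`-averaged kinetic localisation, `L⁻³∫_Ω⟨e^{ikx},T_u e^{ik'x}⟩du =
δ_{k,k'}ℓ³F(k)`). "If `b, s` are small enough, then for all `k ∈ 2πL⁻¹ℤ³ ∖ {0}`,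
`F(k) ≤ k² - 2π²L⁻²`" (3.21). Vendored with `F(k) = ℓ⁻³ · kinLoc χ ℓ s b 0 (cellWave L n)`,
`k = 2πn/L` (`k² = 4π²|n|²/L²`), additively in `ℝ≥0∞`, and with the quantifier order of Lemma 3.3
as vendored (`b`, `s₀` depend on `χ` only; the printed proof scales to `ℓ = 1` and its constants
`β`, `C` of (3.24)–(3.25) depend on `χ` alone). [cite: Fournais2020, (3.19)–(3.21)] -/
def Fournais2020_eq321 : Prop :=
  ∀ χ : Space → ℝ, IsLocalizationFunction χ →
  ∃ b s₀ : ℝ, 0 < b ∧ 0 < s₀ ∧ ∀ s : ℝ, 0 < s → s ≤ s₀ →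
    ∀ (ℓ L : ℝ), 0 < ℓ → 2 * ℓ < L →
    ∀ n : Fin 3 → ℤ, n ≠ 0 →
      (ENNReal.ofReal ℓ ^ 3)⁻¹ * kinLoc χ ℓ s b 0 (cellWave L n) +
          ENNReal.ofReal (2 * Real.pi ^ 2 / L ^ 2) ≤
        ENNReal.ofReal (4 * Real.pi ^ 2 * (∑ j, (n j : ℝ) ^ 2) / L ^ 2)

end Literature.MathematicalPhysics.QuantumManyBody.BoseGas
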